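import Literature.AlgebraicGeometry.Frobenioids.Cor411iiiOfFSMType
import Literature.AlgebraicGeometry.Frobenioids.BaseSectionsOfObjectsCor57Arith
import Literature.AlgebraicGeometry.Frobenioids.ArithmeticFrobenioidThm64ivTransport
import Literature.AlgebraicGeometry.Frobenioids.ArithmeticFrobenioidThm64iRatStdVariants
import Literature.AlgebraicGeometry.Frobenioids.ArithmeticFrobenioidPerfectionDivSlim
import Literature.AlgebraicGeometry.Frobenioids.PerfFactorialPerfection
import Literature.AlgebraicGeometry.Frobenioids.PerfectionDivisorial
import HarnessLib

/-!
# Frobenioids I, Theorem 6.4 (iii)/(iv) at the arithmetic Frobenioids `C_{K/F}`: THE divisor transport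
# `θ : Φ₁(L₁)^pf ⥲ Φ₂(L₂)^pf` induced by an equivalence (row «T64iii/θ-SUPPLY»)

Mochizuki, *The geometry of Frobenioids I*, Kyushu J. Math. **62** (2008), Thm. 6.4 (iii) pp. 114–115 ("the
bijection `V(L₁) ⥲ Prime(Φ₁(L₁)) ⥲ Prime(Φ₂(L₂)) ⥲ V(L₂)` induced by `(Ψ^pf)^un-tr` [cf. (i); Corollary 4.11,
(iii)]"), (iv) p. 115 ("the equivalence `D₁ ⥲ D₂` induced by `Ψ` — cf. (i); Corollary 4.11, (ii)"), Cor. 4.11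
(ii)–(iv) pp. 91–92 [cite: MochizukiFrdI2008, Thm. 6.4 (iii) p.114] [cite: MochizukiFrdI2008, Cor. 4.11 (iii) p.92].

PROOF-ONLY companion (abc-iut-L1-d1 gen 3; L1-lead R113/R114 row «T64iii/θ-SUPPLY at C_{K/F}»). For an
equivalence `Ψ : C_{K₁/F₁} ⥲ C_{K₂/F₂}` between THE arithmetic Frobenioids (`arithFrobenioid`, abc-iut-L6-t10),
[FrdI] Cor. 4.11 (ii)–(iv) are now theorems over bases of FSM-type with perf-factorial divisor monoids
(abc-iut-L1-d6 `PreFrobenioid.cor411ii_ofFunctor_of_isOfFSMType`, abc-iut-L1-t14 `FrdI.cor411iii_of_cor411ii_of_isOfFSMType`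
/ `FrdI.cor411iv_of_cor411ii_of_isOfFSMType`); their hypotheses at `C_{K/F}` are in the tree
(`FinSubextCat.isOfFSMType`, `arith_objectwise_isPerfFactorial`, `cor411Setting_arith`, `cor411ii_arith`,
`arithFrobenioid_isOfRationallyStandardType_rsParams`). Composing (the `1`-uniqueness of the base square of (iv)'s
`Ψ^Base` is transferred from (ii)'s along the `1`-commutativity `η` — abc-iut-L1-d7's `oneUniqueSquare_of_oneCommutes`,
`ArithmeticFrobenioidThm64ivTransport.lean`, whose binders `h411ii` / `h411iv` are DISCHARGED here):

* `arith_isRational_biratData` — `C_{K/F}` is of rational type at THE birationalization and support (the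
  `hrat` binder of the general closers; from abc-iut-L6-t10's Thm. 6.4 (i) at THE parameters);
* `cor411iii_arith`, `cor411iv_arith` — the typed Cor. 4.11 (iii) and (iv) HOLD at every
  `Ψ : C_{K₁/F₁} ⥲ C_{K₂/F₂}` (THE parameters; `cor411ii_arith` is in `BaseSectionsOfObjectsCor57Arith.lean`) — the
  binders `h411ii` / `h411iv` of abc-iut-L1-d7's `exists_transport_of_cor411iv` / `oneUniqueSquare_of_cor411ii_of_iso`
  DISCHARGED;
* `exists_divisorTransport_arith` — hence THE data with NO binder: `Ψ^Base : D₁ ⥲ D₂` with its `1`-unique base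
  square, `η : Base₂ ∘ Ψ ≅ Ψ^Base ∘ Base₁`, the divisor-monoid isomorphism `Ψ^Φ : Φ₁ ⥲ Φ₂` over `Ψ^Base`, the
  bijections of finite places `π_X` with `Ψ^Φ_X(δ_w) = δ_{π_X w}` ("generator ↦ generator", abc-iut-L1-d7), `Ψ`
  preserving Frobenius degrees, `Div(Ψ φ) = η_A^* Ψ^Φ(Div φ)` — the binders `π` / `hsq` of abc-iut-L1-t3's
  `Thm64iv_of_logNorm_transport_schema` / `Thm64iv_of_generatorReadings` at THE data;
* `exists_perfectedDivisorTransport_arith` — **the θ-supply**: for every object `Spec L` of `D₁`, the perfected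
  transport `θ_L : Φ₁(L)^pf ⥲ Φ₂(Ψ^Base L)^pf` (`Perfection.congr` of `Ψ^Φ_L`), given on classes by
  `θ_L (D^{1/n}) = (Ψ^Φ_L D)^{1/n}` and NATURAL along pull-backs — the binder `θ` of abc-iut-L1-d9's
  `thm64iii_of_mulEquiv` / `thm64iii_of_divisorTransport` (Thm. 6.4 (iii)) read in the situation of Thm. 6.4 (iv);
* `exists_perfectedDivisorTransport_at_arith` — the same read at an object `A₁` of `C_{K₁/F₁}` and its image
  `Ψ A₁`: `θ_{A₁} : Φ₁(Base A₁)^pf ⥲ Φ₂(Base (Ψ A₁))^pf` (through `η_{A₁}`), carrying the class of `Div(φ)` to the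
  class of `Div(Ψ φ)` for every `φ : A₁ → B₁`.
* **Print's (iii) hypothesis verbatim** — an equivalence `Ψ' : (C₁^pf)^un-tr ⥲ (C₂^pf)^un-tr` of the
  UNIT-TRIVIALIZED PERFECTIONS (not of `C_i`): `cor411Setting_pfUntr_arith`, `exists_divisorTransport_pfUntr_arith`
  (`Ψ'^Base`, `η'`, `Ψ'^Φ : Φ₁^pf ⥲ Φ₂^pf` over it — the divisor monoid of `(C^pf)^un-tr` IS `Φ^pf`, so NO
  perfecting step — degrees, Div clause) and `exists_perfectedDivisorTransport_pfUntr_at_arith` (`θ_{A₁}` at an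
  object `A₁ ∈ Ob((C₁^pf)^un-tr)` and `A₂ = Ψ'(A₁)`, carrying `Div(φ)` to `Div(Ψ' φ)`): Cor. 4.11 (iii)/(iv) at
  the Frobenioids `((C_{K_i/F_i})^pf)^un-tr` — Frobenioids of standard and rationally standard type, not
  group-like (abc-iut-w4-d086 `arith_pfUntr_variants`, abc-iut-w5-d250 `arith_pfUntr_isOfRationallyStandardType`),
  `Φ^pf` perf-factorial (abc-iut-L1-d2 `PerfectionIsPerfFactorial_holds`), `D` Div-slim w.r.t. `Φ^pf` (abc-iut-L1-t14
  `arithFrobenioid_perfection_isDivSlim`).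

The DEGREE clause of Thm. 6.4 (iii) (`deg^arith ∘ θ = deg(Ψ^rlf) · deg^arith`) is Thm. 6.4 (ii) at the data (rows
(E); abc-iut-w4-d086 / abc-iut-L6-t10) and is NOT claimed here. No definitions, no named facts; nothing here bears
on, or takes a side on, [IUTchIII] Cor. 3.12.
-/

noncomputable section

namespace Literature.AlgebraicGeometry.Frobenioids

open CategoryTheory Opposite
open PreFrobenioid

section Arith

variable {F₁ : Type} [Field F₁] [NumberField F₁] {K₁ : Type} [Field K₁] [Algebra F₁ K₁] [IsGalois F₁ K₁]
variable {F₂ : Type} [Field F₂] [NumberField F₂] {K₂ : Type} [Field K₂] [Algebra F₂ K₂] [IsGalois F₂ K₂]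

variable (F₁ K₁) in
/-- **`C_{K/F}` is of rational type at THE birationalization and THE support predicate** (Def. 4.5 (ii); the
"rational" conjunct of Thm. 6.4 (i) "`C` … is of rationally standard type", p. 114, abc-iut-L6-t10's
`arithFrobenioid_isOfRationallyStandardType_rsParams`) — the `hrat` binder of the general Cor. 4.11 (iii)/(iv)
closers. [cite: MochizukiFrdI2008, Thm. 6.4 (i) p.114] -/
theorem arith_isRational_biratData (A : arithFrobenioid F₁ K₁) :
    PreFrobenioidData.IsRational
      (biratData (arithFrobenioid_isFrobenioid F₁ K₁)
        (hasBiratSquares_of_isFrobenioid (arithFrobenioid_isFrobenioid F₁ K₁)))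
      (S := PreFrobenioidData.ofFunctor (arithDivisorFunctor F₁ K₁)
        (ModelFrobenioid.toElem (arithDivisorFunctor F₁ K₁) (unitsFunctor F₁ K₁) (divNatTrans F₁ K₁)))
      (fun a 𝔭 => PrimarySupp a 𝔭) A :=
  (arithFrobenioid_isOfRationallyStandardType_rsParams F₁ K₁).rational A

/-- **[FrdI] Cor. 4.11 (iii) HOLDS for every equivalence `Ψ : C_{K₁/F₁} ⥲ C_{K₂/F₂}` of arithmetic
Frobenioids**, at THE parameters of Def. 4.5 (iii) (`PreFrobenioid.rsParams`, abc-iut-L6-t10): the typed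
`PreFrobenioidData.Cor411iii` (abc-iut-L1-t14's `FrdI.cor411iii_of_cor411ii_of_isOfFSMType` over `cor411ii_arith`).
[cite: MochizukiFrdI2008, Cor. 4.11 (iii) p.92] -/
theorem cor411iii_arith (Ψ : arithFrobenioid F₁ K₁ ≌ arithFrobenioid F₂ K₂) :
    (arithFrobenioidOps F₁ K₁).Cor411iii (arithFrobenioidOps F₂ K₂) Ψ
      (PreFrobenioid.rsParams (arithFrobenioid_isFrobenioid F₁ K₁) fun a 𝔭 => PrimarySupp a 𝔭)
      (PreFrobenioid.rsParams (arithFrobenioid_isFrobenioid F₂ K₂) fun a 𝔭 => PrimarySupp a 𝔭) :=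
  FrdI.cor411iii_of_cor411ii_of_isOfFSMType (arithFrobenioid_isFrobenioid F₁ K₁) (arithFrobenioid_isFrobenioid F₂ K₂)
    (FinSubextCat.isOfFSMType F₁ K₁) (FinSubextCat.isOfFSMType F₂ K₂)
    (arith_objectwise_isPerfFactorial F₁ K₁) (arith_objectwise_isPerfFactorial F₂ K₂)
    (arith_isRational_biratData F₁ K₁) Ψ _ _ (cor411ii_arith Ψ)

/-- **[FrdI] Cor. 4.11 (iv) HOLDS for every equivalence `Ψ : C_{K₁/F₁} ⥲ C_{K₂/F₂}` of arithmetic Frobenioids**,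
at THE parameters: the typed `PreFrobenioidData.Cor411iv` — abc-iut-L1-t14's `FrdI.cor411iv_of_cor411ii_of_isOfFSMType`
over `cor411ii_arith` (not group-like: Thm. 6.4 (i); rational at THE birationalization). This DISCHARGES the binder
`h411iv` of abc-iut-L1-d7's `exists_transport_of_cor411iv`. [cite: MochizukiFrdI2008, Cor. 4.11 (iv) p.92] -/
theorem cor411iv_arith (Ψ : arithFrobenioid F₁ K₁ ≌ arithFrobenioid F₂ K₂) :
    (arithFrobenioidOps F₁ K₁).Cor411iv (arithFrobenioidOps F₂ K₂) Ψ
      (PreFrobenioid.rsParams (arithFrobenioid_isFrobenioid F₁ K₁) fun a 𝔭 => PrimarySupp a 𝔭)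
      (PreFrobenioid.rsParams (arithFrobenioid_isFrobenioid F₂ K₂) fun a 𝔭 => PrimarySupp a 𝔭) :=
  FrdI.cor411iv_of_cor411ii_of_isOfFSMType (arithFrobenioid_isFrobenioid F₁ K₁)
    (arithFrobenioid_isFrobenioid F₂ K₂) (FinSubextCat.isOfFSMType F₁ K₁) (FinSubextCat.isOfFSMType F₂ K₂)
    (arith_objectwise_isPerfFactorial F₁ K₁) (arith_objectwise_isPerfFactorial F₂ K₂)
    (not_isOfGroupLikeType_arith F₁ K₁) (arith_isRational_biratData F₁ K₁) Ψ _ _ (cor411ii_arith Ψ)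

/-- **THE data of Cor. 4.11 (ii)–(iv) at `Ψ : C_{K₁/F₁} ⥲ C_{K₂/F₂}`** ("the equivalence `D₁ ⥲ D₂` induced by `Ψ`",
Thm. 6.4 (iv) p. 115; Cor. 4.11 pp. 91–92): a `1`-unique `Ψ^Base : D₁ ⥲ D₂` over the base functors,
`η : Base₂ ∘ Ψ ≅ Ψ^Base ∘ Base₁`, a divisor-monoid isomorphism `Ψ^Φ : Φ₁ ⥲ Φ₂` over `Ψ^Base` (natural along
pull-backs), with `Ψ` preserving Frobenius degrees and `Div(Ψ φ) = η_A^* Ψ^Φ(Div φ)` on every arrow — abc-iut-L1-t14's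
`FrdI.cor411iv_of_cor411ii_of_isOfFSMType` over abc-iut-L1-d6's (ii) at the arithmetic Frobenioids, every antecedent
discharged (`cor411ii_arith`, `cor411Setting_arith`, `arith_isRational_biratData`, not group-like, rationally standard
at THE parameters); the `1`-uniqueness of the square transferred from (ii). [cite: MochizukiFrdI2008, Cor. 4.11 (iv) p.92] -/
theorem exists_divisorTransport_arith (Ψ : arithFrobenioid F₁ K₁ ≌ arithFrobenioid F₂ K₂) :
    ∃ (ΨBase : FinSubextCat F₁ K₁ ⥤ FinSubextCat F₂ K₂)
      (E : (arithFrobenioidOps F₁ K₁).DivisorMonoidIsoOverBase (arithFrobenioidOps F₂ K₂) ΨBase)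
      (η : Ψ.functor ⋙ (arithFrobenioidOps F₂ K₂).base ≅ (arithFrobenioidOps F₁ K₁).base ⋙ ΨBase)
      (π : ∀ X : FinSubextCat F₁ K₁, NumberField.FinitePlace X.L ≃ NumberField.FinitePlace (ΨBase.obj X).L),
      PreFrobenioidData.OneUniqueSquare Ψ.functor (arithFrobenioidOps F₁ K₁).base
          (arithFrobenioidOps F₂ K₂).base ΨBase ∧
        PreFrobenioidData.PreservesDegFr (arithFrobenioidOps F₁ K₁) (arithFrobenioidOps F₂ K₂) Ψ ∧
        (∀ (X : FinSubextCat F₁ K₁) (w : NumberField.FinitePlace X.L),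
          E.iso X (Multiplicative.ofAdd (EffArithDivisor.single X.L (Sum.inr w))) =
            Multiplicative.ofAdd (EffArithDivisor.single (ΨBase.obj X).L (Sum.inr (π X w)))) ∧
        ∀ ⦃A B : arithFrobenioid F₁ K₁⦄ (φ : A ⟶ B),
          (arithFrobenioidOps F₂ K₂).div (Ψ.functor.map φ) =
            (arithFrobenioidOps F₂ K₂).pull (η.hom.app A)
              (E.iso ((arithFrobenioidOps F₁ K₁).base.obj A) ((arithFrobenioidOps F₁ K₁).div φ)) := by
  obtain ⟨ΨBase, E, η, π, hEq, hdeg, hπ, hdiv⟩ := exists_transport_of_cor411iv Ψ (cor411iv_arith Ψ)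
  exact ⟨ΨBase, E, η, π, oneUniqueSquare_of_cor411ii_of_iso Ψ (cor411ii_arith Ψ) hEq η, hdeg, hπ, hdiv⟩

/-- **THE θ-SUPPLY (Thm. 6.4 (iii)/(iv) at `C_{K/F}`)**: for `Ψ : C_{K₁/F₁} ⥲ C_{K₂/F₂}`, with `Ψ^Base`, `Ψ^Φ`, `η` as
in `exists_divisorTransport_arith`, the PERFECTED divisor transport at every `Spec L ∈ Ob(D₁)`,
`θ_L : Φ₁(L)^pf ⥲ Φ₂(Ψ^Base L)^pf` — on classes `θ_L (D^{1/n}) = (Ψ^Φ_L D)^{1/n}`, natural along the pull-back maps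
of `D₁` — i.e. the isomorphism "`Prime(Φ₁(L₁)) ⥲ Prime(Φ₂(L₂))` … induced by [the equivalence] [cf. Corollary
4.11, (iii)]" read on the perfections (print, Thm. 6.4 (iii) p. 115 l. 3–6). This is the binder `θ` of
abc-iut-L1-d9's `thm64iii_of_mulEquiv`. [cite: MochizukiFrdI2008, Thm. 6.4 (iii) p.115] -/
theorem exists_perfectedDivisorTransport_arith (Ψ : arithFrobenioid F₁ K₁ ≌ arithFrobenioid F₂ K₂) :
    ∃ (ΨBase : FinSubextCat F₁ K₁ ⥤ FinSubextCat F₂ K₂)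
      (E : (arithFrobenioidOps F₁ K₁).DivisorMonoidIsoOverBase (arithFrobenioidOps F₂ K₂) ΨBase)
      (η : Ψ.functor ⋙ (arithFrobenioidOps F₂ K₂).base ≅ (arithFrobenioidOps F₁ K₁).base ⋙ ΨBase)
      (θ : ∀ X : FinSubextCat F₁ K₁,
        Perfection (Multiplicative (EffArithDivisor X.L)) ≃*
          Perfection (Multiplicative (EffArithDivisor (ΨBase.obj X).L))),
      PreFrobenioidData.OneUniqueSquare Ψ.functor (arithFrobenioidOps F₁ K₁).base
          (arithFrobenioidOps F₂ K₂).base ΨBase ∧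
        PreFrobenioidData.PreservesDegFr (arithFrobenioidOps F₁ K₁) (arithFrobenioidOps F₂ K₂) Ψ ∧
        (∀ ⦃A B : arithFrobenioid F₁ K₁⦄ (φ : A ⟶ B),
          (arithFrobenioidOps F₂ K₂).div (Ψ.functor.map φ) =
            (arithFrobenioidOps F₂ K₂).pull (η.hom.app A)
              (E.iso ((arithFrobenioidOps F₁ K₁).base.obj A) ((arithFrobenioidOps F₁ K₁).div φ))) ∧
        (∀ (X : FinSubextCat F₁ K₁) (D : Multiplicative (EffArithDivisor X.L)) (n : ℕ+),
          θ X (Perfection.mk D n) = Perfection.mk (E.iso X D) n) ∧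
        ∀ ⦃X Y : FinSubextCat F₁ K₁⦄ (f : Y ⟶ X) (x : Perfection (Multiplicative (EffArithDivisor X.L))),
          θ Y (Perfection.map ((arithFrobenioidOps F₁ K₁).pull f) x) =
            Perfection.map ((arithFrobenioidOps F₂ K₂).pull (ΨBase.map f)) (θ X x) := by
  obtain ⟨ΨBase, E, η, -, hsq, hdeg, -, hdiv⟩ := exists_divisorTransport_arith Ψ
  refine ⟨ΨBase, E, η, fun X => Perfection.congr (E.iso X), hsq, hdeg, hdiv, fun X D n => rfl, ?_⟩
  intro X Y f x
  obtain ⟨⟨a, n⟩, rfl⟩ := Perfection.mk_surjective x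
  -- `map`/`congr` compute on classes by `rfl`; the class-level identity is the naturality of `Ψ^Φ`
  exact congrArg (fun z => Perfection.mk z n) (E.natural f a)

/-- **The θ-supply read at an object `A₁ ∈ Ob(C_{K₁/F₁})` and its image `A₂ = Ψ(A₁)`** (the shape of Thm. 6.4
(iii): "`A₂ = (Ψ^pf)^un-tr(A₁)` [whose projection to `D_i` we denote by `Spec(L_i)`]", p. 115): the perfected
transport `θ_{A₁} : Φ₁(L₁)^pf ⥲ Φ₂(L₂)^pf`, `L₁ := Base(A₁)`, `L₂ := Base(Ψ A₁)` — `Ψ^Φ` at `Base(A₁)` followed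
by the pull-back along the isomorphism `η_{A₁} : Base(Ψ A₁) ≅ Ψ^Base(Base A₁)` — which carries the class of
`Div(φ)` to the class of `Div(Ψ φ)` for every arrow `φ : A₁ → B₁` (Cor. 4.11 (iv)), `Ψ` preserving Frobenius
degrees. [cite: MochizukiFrdI2008, Thm. 6.4 (iii) p.115] -/
theorem exists_perfectedDivisorTransport_at_arith (Ψ : arithFrobenioid F₁ K₁ ≌ arithFrobenioid F₂ K₂)
    (A₁ : arithFrobenioid F₁ K₁) :
    ∃ θ : Perfection (Multiplicative (EffArithDivisor ((arithFrobenioidOps F₁ K₁).base.obj A₁).L)) ≃*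
        Perfection (Multiplicative (EffArithDivisor ((arithFrobenioidOps F₂ K₂).base.obj (Ψ.functor.obj A₁)).L)),
      PreFrobenioidData.PreservesDegFr (arithFrobenioidOps F₁ K₁) (arithFrobenioidOps F₂ K₂) Ψ ∧
        ∀ ⦃B₁ : arithFrobenioid F₁ K₁⦄ (φ : A₁ ⟶ B₁),
          θ (Perfection.of _ ((arithFrobenioidOps F₁ K₁).div φ)) =
            Perfection.of _ ((arithFrobenioidOps F₂ K₂).div (Ψ.functor.map φ)) := by
  obtain ⟨ΨBase, E, η, -, -, hdeg, -, hdiv⟩ := exists_divisorTransport_arith Ψ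
  -- the pull-back along the isomorphism `η_{A₁}` as a multiplicative equivalence
  let P := (arithFrobenioidOps F₂ K₂).base.obj (Ψ.functor.obj A₁)
  let Q := ΨBase.obj ((arithFrobenioidOps F₁ K₁).base.obj A₁)
  let g : P ≅ Q := η.app A₁
  have h₁ : ((arithFrobenioidOps F₂ K₂).pull g.inv).comp ((arithFrobenioidOps F₂ K₂).pull g.hom) =
      MonoidHom.id _ := by
    refine MonoidHom.ext fun x => ?_
    rw [MonoidHom.comp_apply, ← (arithFrobenioidOps F₂ K₂).pull_comp, Iso.inv_hom_id,
      (arithFrobenioidOps F₂ K₂).pull_id]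
    rfl
  have h₂ : ((arithFrobenioidOps F₂ K₂).pull g.hom).comp ((arithFrobenioidOps F₂ K₂).pull g.inv) =
      MonoidHom.id _ := by
    refine MonoidHom.ext fun x => ?_
    rw [MonoidHom.comp_apply, ← (arithFrobenioidOps F₂ K₂).pull_comp, Iso.hom_inv_id,
      (arithFrobenioidOps F₂ K₂).pull_id]
    rfl
  let e : (arithFrobenioidOps F₂ K₂).Mon Q ≃* (arithFrobenioidOps F₂ K₂).Mon P :=
    MonoidHom.toMulEquiv ((arithFrobenioidOps F₂ K₂).pull g.hom) ((arithFrobenioidOps F₂ K₂).pull g.inv) h₁ h₂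
  refine ⟨(Perfection.congr (E.iso ((arithFrobenioidOps F₁ K₁).base.obj A₁))).trans (Perfection.congr e),
    hdeg, fun B₁ φ => ?_⟩
  -- `congr _ (of a) = of (_ a)` and `e = η_{A₁}^*` compute by `rfl`; the identity is Cor. 4.11 (iv)'s Div clause
  exact congrArg (Perfection.of _) (hdiv φ).symm

/-! ### Print's (iii) hypothesis: an equivalence of the unit-trivialized perfections `(C_i^pf)^un-tr` -/

/-- `Φ^pf` (the divisor monoid of THE perfection `C_{K/F}^pf`, hence of `(C_{K/F}^pf)^un-tr`) is perf-factorial,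
objectwise ("`M^pf` … [is] also perf-factorial", Def. 2.4 (i) p. 48; abc-iut-L1-d2 `PerfectionIsPerfFactorial_holds`).
[cite: MochizukiFrdI2008, Def. 2.4 (i) p.48] -/
theorem arith_pf_objectwise_isPerfFactorial :
    Objectwise (fun M _ => IsPerfFactorial M)
      (PreFrobenioid.Perfection.ops (arithFrobenioid_isFrobenioid F₁ K₁)).monFunctor :=
  fun X => PerfectionIsPerfFactorial_holds (arith_objectwise_isPerfFactorial F₁ K₁ X)

/-- `D = B(Gal(K/F))⁰` is Div-slim with respect to the divisor monoid `Φ^pf` of `(C_{K/F}^pf)^un-tr` ("Div-slim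
[relative to `Φ`, hence also relative to `Φ^pf` …]", Thm. 6.4 (i) p. 115 l. 36–37; abc-iut-L1-t14's
`arithFrobenioid_perfection_isDivSlim`, the operations of `(C^pf)^un-tr` having the same divisor monoids and
pull-backs as those of `C^pf`). [cite: MochizukiFrdI2008, Thm. 6.4 (i) p.115] -/
theorem arith_pfUntr_isDivSlim :
    (PreFrobenioidData.ofFunctor _ (untrFunctor (arith_pf_isFrobenioid F₁ K₁))).IsDivSlim :=
  PreFrobenioidData.IsDivSlim.of_injective_hom (PreFrobenioid.Perfection.ops (arithFrobenioid_isFrobenioid F₁ K₁))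
    _ (fun _ x => x) (fun _ _ _ h => h) (fun _ _ => rfl) (arithFrobenioid_perfection_isDivSlim F₁ K₁)

variable (F₁ K₁) in
/-- `(C_{K/F}^pf)^un-tr` is of rational type at THE birationalization and support (Thm. 6.4 (i) for
`(C^pf)^un-tr`, p. 115 l. 39–40 via Prop. 5.5 (iii); abc-iut-w5-d250). [cite: MochizukiFrdI2008, Thm. 6.4 (i) p.115] -/
theorem arith_pfUntr_isRational_biratData
    (A : (PreFrobenioidData.ofFunctor _
      (PreFrobenioid.Perfection.ops (arithFrobenioid_isFrobenioid F₁ K₁)).toFunctor).Untr) :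
    PreFrobenioidData.IsRational
      (biratData (isFrobenioid_untr (arith_pf_isFrobenioid F₁ K₁))
        (hasBiratSquares_of_isFrobenioid (isFrobenioid_untr (arith_pf_isFrobenioid F₁ K₁))))
      (S := PreFrobenioidData.ofFunctor _ (untrFunctor (arith_pf_isFrobenioid F₁ K₁)))
      (fun a 𝔭 => PrimarySupp a 𝔭) A :=
  (arith_pfUntr_isOfRationallyStandardType F₁ K₁).rational A

/-- **The Cor. 4.11 hypothesis package HOLDS at every `Ψ' : (C_{K₁/F₁}^pf)^un-tr ⥲ (C_{K₂/F₂}^pf)^un-tr`** (Div-slim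
w.r.t. `Φ^pf`, standard type — Thm. 6.4 (i) for `(C^pf)^un-tr` —, hypothesis (b) idle: not group-like).
[cite: MochizukiFrdI2008, Cor. 4.11 p.91] -/
theorem cor411Setting_pfUntr_arith
    (Ψ' : (PreFrobenioidData.ofFunctor _
        (PreFrobenioid.Perfection.ops (arithFrobenioid_isFrobenioid F₁ K₁)).toFunctor).Untr ≌
      (PreFrobenioidData.ofFunctor _
        (PreFrobenioid.Perfection.ops (arithFrobenioid_isFrobenioid F₂ K₂)).toFunctor).Untr) :
    (PreFrobenioidData.ofFunctor _ (untrFunctor (arith_pf_isFrobenioid F₁ K₁))).Cor411Setting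
      (PreFrobenioidData.ofFunctor _ (untrFunctor (arith_pf_isFrobenioid F₂ K₂))) Ψ' where
  divSlim := ⟨arith_pfUntr_isDivSlim, arith_pfUntr_isDivSlim⟩
  standard := ⟨(arith_pfUntr_variants F₁ K₁).2.2.2.1, (arith_pfUntr_variants F₂ K₂).2.2.2.1⟩
  hypB h₁ _ := absurd h₁ (arith_pfUntr_variants F₁ K₁).2.2.1

/-- **THE data of Cor. 4.11 (ii)–(iv) at `Ψ' : (C_{K₁/F₁}^pf)^un-tr ⥲ (C_{K₂/F₂}^pf)^un-tr`** — print's hypothesis of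
Thm. 6.4 (iii) ("arises from an equivalence … between the unit-trivialized perfections", p. 114–115): `Ψ'^Base`
with its `1`-unique base square, `η'`, the divisor-monoid isomorphism `Ψ'^Φ : Φ₁^pf ⥲ Φ₂^pf` over `Ψ'^Base` (ITS
values are already the perfected monoids `Φ_i(L)^pf`), natural along pull-backs, `Ψ'` preserving Frobenius degrees,
`Div(Ψ' φ) = η'_A^* Ψ'^Φ(Div φ)` on every arrow (abc-iut-L1-d6's (ii) and abc-iut-L1-t14's (ii) ⇒ (iv) at the
Frobenioids `((C_{K_i/F_i})^pf)^un-tr`). [cite: MochizukiFrdI2008, Thm. 6.4 (iii) p.114] -/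
theorem exists_divisorTransport_pfUntr_arith
    (Ψ' : (PreFrobenioidData.ofFunctor _
        (PreFrobenioid.Perfection.ops (arithFrobenioid_isFrobenioid F₁ K₁)).toFunctor).Untr ≌
      (PreFrobenioidData.ofFunctor _
        (PreFrobenioid.Perfection.ops (arithFrobenioid_isFrobenioid F₂ K₂)).toFunctor).Untr) :
    ∃ (ΨBase : FinSubextCat F₁ K₁ ⥤ FinSubextCat F₂ K₂)
      (E : (PreFrobenioidData.ofFunctor _ (untrFunctor (arith_pf_isFrobenioid F₁ K₁))).DivisorMonoidIsoOverBase
        (PreFrobenioidData.ofFunctor _ (untrFunctor (arith_pf_isFrobenioid F₂ K₂))) ΨBase)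
      (η : Ψ'.functor ⋙ (PreFrobenioidData.ofFunctor _ (untrFunctor (arith_pf_isFrobenioid F₂ K₂))).base ≅
        (PreFrobenioidData.ofFunctor _ (untrFunctor (arith_pf_isFrobenioid F₁ K₁))).base ⋙ ΨBase),
      PreFrobenioidData.OneUniqueSquare Ψ'.functor
          (PreFrobenioidData.ofFunctor _ (untrFunctor (arith_pf_isFrobenioid F₁ K₁))).base
          (PreFrobenioidData.ofFunctor _ (untrFunctor (arith_pf_isFrobenioid F₂ K₂))).base ΨBase ∧
        PreFrobenioidData.PreservesDegFr
          (PreFrobenioidData.ofFunctor _ (untrFunctor (arith_pf_isFrobenioid F₁ K₁)))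
          (PreFrobenioidData.ofFunctor _ (untrFunctor (arith_pf_isFrobenioid F₂ K₂))) Ψ' ∧
        (∀ ⦃A B : (PreFrobenioidData.ofFunctor _
            (PreFrobenioid.Perfection.ops (arithFrobenioid_isFrobenioid F₁ K₁)).toFunctor).Untr⦄ (φ : A ⟶ B),
          (PreFrobenioidData.ofFunctor _ (untrFunctor (arith_pf_isFrobenioid F₂ K₂))).div (Ψ'.functor.map φ) =
            (PreFrobenioidData.ofFunctor _ (untrFunctor (arith_pf_isFrobenioid F₂ K₂))).pull (η.hom.app A)
              (E.iso ((PreFrobenioidData.ofFunctor _ (untrFunctor (arith_pf_isFrobenioid F₁ K₁))).base.obj A)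
                ((PreFrobenioidData.ofFunctor _ (untrFunctor (arith_pf_isFrobenioid F₁ K₁))).div φ))) ∧
        ∀ ⦃X Y : FinSubextCat F₁ K₁⦄ (f : Y ⟶ X)
          (x : (PreFrobenioidData.ofFunctor _ (untrFunctor (arith_pf_isFrobenioid F₁ K₁))).Mon X),
          E.iso Y ((PreFrobenioidData.ofFunctor _ (untrFunctor (arith_pf_isFrobenioid F₁ K₁))).pull f x) =
            (PreFrobenioidData.ofFunctor _ (untrFunctor (arith_pf_isFrobenioid F₂ K₂))).pull (ΨBase.map f)
              (E.iso X x) := by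
  have hs := cor411Setting_pfUntr_arith Ψ'
  have h2 := PreFrobenioid.cor411ii_ofFunctor_of_isOfFSMType (isFrobenioid_untr (arith_pf_isFrobenioid F₁ K₁))
    (isFrobenioid_untr (arith_pf_isFrobenioid F₂ K₂)) Ψ' arith_pf_objectwise_isPerfFactorial
    arith_pf_objectwise_isPerfFactorial (FinSubextCat.isOfFSMType F₁ K₁) (FinSubextCat.isOfFSMType F₂ K₂)
  obtain ⟨ΨBase₀, hsq₀, -⟩ := h2 hs
  obtain ⟨ΨBase, E, η, hEq, hdeg, hdiv, -⟩ :=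
    FrdI.cor411iv_of_cor411ii_of_isOfFSMType (isFrobenioid_untr (arith_pf_isFrobenioid F₁ K₁))
      (isFrobenioid_untr (arith_pf_isFrobenioid F₂ K₂)) (FinSubextCat.isOfFSMType F₁ K₁)
      (FinSubextCat.isOfFSMType F₂ K₂) arith_pf_objectwise_isPerfFactorial arith_pf_objectwise_isPerfFactorial
      (arith_pfUntr_variants F₁ K₁).2.2.1 (arith_pfUntr_isRational_biratData F₁ K₁) Ψ' _ _ h2 hs
      (arith_pfUntr_isOfRationallyStandardType F₁ K₁) (arith_pfUntr_isOfRationallyStandardType F₂ K₂)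
  exact ⟨ΨBase, E, η, oneUniqueSquare_of_oneCommutes hsq₀ hEq ⟨η⟩, hdeg, hdiv, fun X Y f x => E.natural f x⟩

/-- **Thm. 6.4 (iii)'s θ at an object, from print's hypothesis**: for `Ψ' : (C_{K₁/F₁}^pf)^un-tr ⥲ (C_{K₂/F₂}^pf)^un-tr`
and `A₁ ∈ Ob((C₁^pf)^un-tr)` "[whose projection to `D₁` we denote by `Spec(L₁)`]", `A₂ = Ψ'(A₁)` over `Spec(L₂)`
(p. 115 l. 1–4): the transport `θ : Φ₁(L₁)^pf ⥲ Φ₂(L₂)^pf` "induced by `(Ψ^pf)^un-tr` [cf. (i); Corollary 4.11, (iii)]"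
(`Ψ'^Φ` at `Base A₁` followed by the pull-back along the isomorphism `η'_{A₁}`), carrying `Div(φ)` to `Div(Ψ' φ)`
for every arrow `φ : A₁ → B₁`, `Ψ'` preserving Frobenius degrees — the binder `θ` of abc-iut-L1-d9's
`thm64iii_of_mulEquiv` at print's data. [cite: MochizukiFrdI2008, Thm. 6.4 (iii) p.115] -/
theorem exists_perfectedDivisorTransport_pfUntr_at_arith
    (Ψ' : (PreFrobenioidData.ofFunctor _
        (PreFrobenioid.Perfection.ops (arithFrobenioid_isFrobenioid F₁ K₁)).toFunctor).Untr ≌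
      (PreFrobenioidData.ofFunctor _
        (PreFrobenioid.Perfection.ops (arithFrobenioid_isFrobenioid F₂ K₂)).toFunctor).Untr)
    (A₁ : (PreFrobenioidData.ofFunctor _
      (PreFrobenioid.Perfection.ops (arithFrobenioid_isFrobenioid F₁ K₁)).toFunctor).Untr) :
    ∃ θ : Perfection (Multiplicative (EffArithDivisor
          ((PreFrobenioidData.ofFunctor _ (untrFunctor (arith_pf_isFrobenioid F₁ K₁))).base.obj A₁).L)) ≃*
        Perfection (Multiplicative (EffArithDivisor
          ((PreFrobenioidData.ofFunctor _ (untrFunctor (arith_pf_isFrobenioid F₂ K₂))).base.obj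
            (Ψ'.functor.obj A₁)).L)),
      PreFrobenioidData.PreservesDegFr
          (PreFrobenioidData.ofFunctor _ (untrFunctor (arith_pf_isFrobenioid F₁ K₁)))
          (PreFrobenioidData.ofFunctor _ (untrFunctor (arith_pf_isFrobenioid F₂ K₂))) Ψ' ∧
        ∀ ⦃B₁ : (PreFrobenioidData.ofFunctor _
            (PreFrobenioid.Perfection.ops (arithFrobenioid_isFrobenioid F₁ K₁)).toFunctor).Untr⦄ (φ : A₁ ⟶ B₁),
          θ ((PreFrobenioidData.ofFunctor _ (untrFunctor (arith_pf_isFrobenioid F₁ K₁))).div φ) =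
            (PreFrobenioidData.ofFunctor _ (untrFunctor (arith_pf_isFrobenioid F₂ K₂))).div (Ψ'.functor.map φ) := by
  obtain ⟨ΨBase, E, η, -, hdeg, hdiv, -⟩ := exists_divisorTransport_pfUntr_arith Ψ'
  let S₂ := PreFrobenioidData.ofFunctor _ (untrFunctor (arith_pf_isFrobenioid F₂ K₂))
  let P := S₂.base.obj (Ψ'.functor.obj A₁)
  let Q := ΨBase.obj ((PreFrobenioidData.ofFunctor _ (untrFunctor (arith_pf_isFrobenioid F₁ K₁))).base.obj A₁)
  let g : P ≅ Q := η.app A₁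
  have h₁ : (S₂.pull g.inv).comp (S₂.pull g.hom) = MonoidHom.id _ := by
    refine MonoidHom.ext fun x => ?_
    rw [MonoidHom.comp_apply, ← S₂.pull_comp, Iso.inv_hom_id, S₂.pull_id]
    rfl
  have h₂ : (S₂.pull g.hom).comp (S₂.pull g.inv) = MonoidHom.id _ := by
    refine MonoidHom.ext fun x => ?_
    rw [MonoidHom.comp_apply, ← S₂.pull_comp, Iso.hom_inv_id, S₂.pull_id]
    rfl
  let e : S₂.Mon Q ≃* S₂.Mon P := MonoidHom.toMulEquiv (S₂.pull g.hom) (S₂.pull g.inv) h₁ h₂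
  refine ⟨(E.iso ((PreFrobenioidData.ofFunctor _ (untrFunctor (arith_pf_isFrobenioid F₁ K₁))).base.obj A₁)).trans e,
    hdeg, fun B₁ φ => ?_⟩
  exact (hdiv φ).symm

end Arith

end Literature.AlgebraicGeometry.Frobenioids

end
-- enqueue re-land 2026-08-26T10:12:03Z (abc-iut-L1-d1 g4): comment-only, declarations byte-identical to p428043; purpose = re-dispatch the stranded olean build (module unbuilt > 70 min after ACCEPT; all 7 parents built)
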